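import Summits.Ventures.Crystal3D.Theorems.StickyWulffConstantCoaxialWallLawEndRowDefs
import Summits.Ventures.Crystal3D.Theorems.StickyWulffConstantCoaxialWallLawTwoLatticeReadings
import Literature.MathematicalPhysics.StatisticalMechanics.BarlowBilayers
import Literature.MathematicalPhysics.StatisticalMechanics.BarlowCoordination
import Summits.Ventures.Crystal3D.Theorems.StickyWulffConstantGenericWallFloorCapStartBarlowStep
import HarnessLib

/-!
# (D4″) THE FRAME LEMMA on Barlow windows: every `v2(A)` reading frame has the forward or the reversed slot dozen

HONEST FRAMING. Venture `Summits/Ventures/Crystal3D` (cell `crystal3d-full`), helper `--supports` the crux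
`CoaxialWallLaw` (stmt-Ventures-19481, `route-Ventures-StickyWulffConstant`), REGISTERED line `WallLedgerF` (planner
cf-p1).  Rung credit; F-C1 not moved; census-free, no kissing facts.  cf-p1 ORDER OF RECORD for 19481-p2 g8
(2026-08-28T21:28:15Z) item (2), lemma (D4″) in its U-W form (PREREG-F-CERT §2: the on-site universe is every
Barlow stacking visible in the payer window): this is what makes the `∀ L` of the typed rows `EndRowTransA` /
`EndRowTwinHalfTurnA` finite on-site.

SETTING.  `Λ(s) = barlowStacking 1 √(2/3) s` (any Hägg sequence `s`, model position), `D₊ = fccSlots` (the slot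
dozen of the model fcc lattice) and `D₋ = basalMirror '' fccSlots` (its basal twin).  A configuration `X` whose
unit sphere about a site `q ∈ Λ(s)` lies on `Λ(s)` (a Barlow WINDOW around `q`, vacancies allowed).

* `barlow_neighbour_mem` — for sites `q, x ∈ Λ(s)` at distance `1`, `x − q ∈ D₊ ∪ D₋` (the eighteen-vector neighbour
  menu: the basal hexagon and the two hole triples above and below; from `dist_barlowPos_eq_iff`);
* `inner_ne_half_of_offPlane` — an off-plane slot of `D₊` and an off-plane vector of `D₋` never meet at `60°`;
  `face_pure_of_neighbourMenu` — hence a `60°` triangle inside `D₊ ∪ D₋` lies in `D₊` or in `D₋`;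
* **`frame_of_isFull_barlow`**, **`frame_of_isTwinReading_barlow`**, **`frame_of_isNarrow_barlow`** — a FULL, TWIN-DOZEN
  or NARROW reading at `q` by the frame `G` forces `G '' fccSlots = D₊` or `= D₋` (a registered `60°` face of
  `G`-slots and `image_fccSlots_eq_of_triangle`); **`frame_of_mover_barlow`** — the same for every mover clause of
  `IsEndMove X v G d q b` (any version).
READING: on a Barlow window the only frames that can carry a `v2(A)` mover are, up to the model symmetries, the two
standard ones; with the class-collapse lemma (sibling file) the on-site statistic of every plate system is
dominated by one of the `20` signature rows of `…EndRowOnSiteDefsA`.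
WHAT THIS IS NOT: not the on-site fact, not the tail; F-C1 not moved.
-/

noncomputable section

namespace Summit.Ventures.Crystal3D.Theorems

open Summit.Ventures.Crystal3D Finset
open Literature.MathematicalPhysics.StatisticalMechanics (barlowPos barlowStacking fccStacking constHagg IsHaggSeq
  haggLabel haggLabel_succ haggLabel_const basalMirror basalMirror_barlowPos_constHagg basalMirror_apply_coord
  triangularVec₁ triangularVec₂ barlowOffset layerNormal sixOffsets threeOffsets dist_barlowPos_eq_iff)
open scoped InnerProductSpace

/-! ### Slots as explicit lattice points -/

/-- An explicit `barlowPos` of the model fcc lattice with a slot triple is a slot. -/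
theorem barlowPos_mem_fccSlots {k i j : ℤ} (h : (k, i, j) ∈ fccSlotTriples) :
    barlowPos 1 (Real.sqrt (2 / 3)) constHagg k i j ∈ fccSlots :=
  mem_image.2 ⟨(k, i, j), h, rfl⟩

/-- The model fcc point `(k, i, j)` expanded. -/
theorem barlowPos_constHagg_eq (k i j : ℤ) :
    barlowPos 1 (Real.sqrt (2 / 3)) constHagg k i j =
      (i : ℝ) • triangularVec₁ 1 + (j : ℝ) • triangularVec₂ 1 + (k : ℝ) • barlowOffset 1 +
        (k : ℝ) • layerNormal (Real.sqrt (2 / 3)) := by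
  simp only [barlowPos, haggLabel_const]

/-- The difference of two sites of a Barlow stacking, expanded. -/
theorem barlowPos_sub_barlowPos (s : ℤ → ℤ) (k i j k' i' j' : ℤ) :
    barlowPos 1 (Real.sqrt (2 / 3)) s k' i' j' - barlowPos 1 (Real.sqrt (2 / 3)) s k i j =
      ((i' - i : ℤ) : ℝ) • triangularVec₁ 1 + ((j' - j : ℤ) : ℝ) • triangularVec₂ 1 +
        ((haggLabel s k' - haggLabel s k : ℤ) : ℝ) • barlowOffset 1 +
        ((k' - k : ℤ) : ℝ) • layerNormal (Real.sqrt (2 / 3)) := by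
  simp only [barlowPos]
  push_cast
  module

/-! ### The eighteen-vector neighbour menu of a Barlow site -/

/-- **Neighbour menu.**  Two sites of a Barlow stacking (ideal spacing) at distance `1` differ by a vector of
`D₊ = fccSlots` or of `D₋ = basalMirror '' fccSlots`. -/
theorem barlow_neighbour_mem {s : ℤ → ℤ} (hs : IsHaggSeq s) {q x : EuclideanSpace ℝ (Fin 3)}
    (hq : q ∈ barlowStacking 1 (Real.sqrt (2 / 3)) s) (hx : x ∈ barlowStacking 1 (Real.sqrt (2 / 3)) s)
    (hd : dist q x = 1) :
    x - q ∈ fccSlots ∨ x - q ∈ (basalMirror : EuclideanSpace ℝ (Fin 3) → EuclideanSpace ℝ (Fin 3)) '' ↑fccSlots := by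
  obtain ⟨k, i, j, rfl⟩ := hq
  obtain ⟨k', i', j', rfl⟩ := hx
  have hh : Real.sqrt (2 / 3) ^ 2 = 2 / 3 * (1 : ℝ) ^ 2 := by rw [Real.sq_sqrt (by norm_num)]; ring
  rw [barlowPos_sub_barlowPos]
  rcases (dist_barlowPos_eq_iff hs one_pos hh k i j k' i' j').1 hd with ⟨rfl, hm⟩ | ⟨rfl, hm⟩ | ⟨rfl, hm⟩
  · -- in-layer: a basal slot
    left
    have key : ∀ PQ ∈ sixOffsets, ((0 : ℤ), -PQ.1, -PQ.2) ∈ fccSlotTriples := by decide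
    have hmem := barlowPos_mem_fccSlots (key _ hm)
    rw [barlowPos_constHagg_eq] at hmem
    convert hmem using 1
    rw [sub_self, sub_self]; push_cast; module
  · -- layer above
    rcases hs k with h1 | h1
    · -- step `+1`: a rising slot of `D₊`
      left
      have key : ∀ PQ ∈ threeOffsets (-1), ((1 : ℤ), -PQ.1, -PQ.2) ∈ fccSlotTriples := by decide
      rw [h1] at hm
      have hmem := barlowPos_mem_fccSlots (key _ hm)
      rw [barlowPos_constHagg_eq] at hmem
      convert hmem using 1
      rw [haggLabel_succ, h1, add_sub_cancel_left, add_sub_cancel_left]; push_cast; module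
    · -- step `−1`: a rising vector of `D₋`
      right
      have key : ∀ PQ ∈ threeOffsets 1, ((-1 : ℤ), -PQ.1, -PQ.2) ∈ fccSlotTriples := by decide
      rw [h1, neg_neg] at hm
      refine ⟨barlowPos 1 (Real.sqrt (2 / 3)) constHagg (-1) (-(i - i')) (-(j - j')),
        mem_coe.2 (barlowPos_mem_fccSlots (key _ hm)), ?_⟩
      rw [basalMirror_barlowPos_constHagg, haggLabel_succ, h1, add_sub_cancel_left, add_sub_cancel_left]
      push_cast; module
  · -- layer below
    rcases hs (k - 1) with h1 | h1
    · -- step `+1` below: a falling slot of `D₊`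
      left
      have key : ∀ PQ ∈ threeOffsets 1, ((-1 : ℤ), -PQ.1, -PQ.2) ∈ fccSlotTriples := by decide
      rw [h1] at hm
      have hmem := barlowPos_mem_fccSlots (key _ hm)
      rw [barlowPos_constHagg_eq] at hmem
      have hL : haggLabel s (k - 1) - haggLabel s k = -1 := by
        have := haggLabel_succ (s := s) (k - 1); rw [sub_add_cancel, h1] at this; omega
      convert hmem using 1
      rw [hL, show k - 1 - k = -1 by ring]; push_cast; module
    · -- step `−1` below: a falling vector of `D₋`
      right
      have key : ∀ PQ ∈ threeOffsets (-1), ((1 : ℤ), -PQ.1, -PQ.2) ∈ fccSlotTriples := by decide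
      rw [h1] at hm
      refine ⟨barlowPos 1 (Real.sqrt (2 / 3)) constHagg 1 (-(i - i')) (-(j - j')),
        mem_coe.2 (barlowPos_mem_fccSlots (key _ hm)), ?_⟩
      have hL : haggLabel s (k - 1) - haggLabel s k = 1 := by
        have := haggLabel_succ (s := s) (k - 1); rw [sub_add_cancel, h1] at this; omega
      rw [basalMirror_barlowPos_constHagg, hL, show k - 1 - k = -1 by ring]
      push_cast; module

/-! ### `60°` triangles in the neighbour menu are pure -/

/-- The basal mirror in the form `M x = x − 2 x₂ e₃`: its inner products. -/
theorem inner_basalMirror_right (a b : EuclideanSpace ℝ (Fin 3)) :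
    ⟪a, basalMirror b⟫_ℝ = ⟪a, b⟫_ℝ - 2 * (a 2 * b 2) := by
  simp only [EuclideanSpace.inner_eq_star_dotProduct, dotProduct, Fin.sum_univ_three, basalMirror_apply_coord,
    star_trivial]
  simp; ring

/-- **No `60°` between off-plane vectors of the two dozens**: a slot `a` with `a₂ ≠ 0` and the mirror image of a
slot `b` with `b₂ ≠ 0` do not meet at inner product `½`. -/
theorem inner_ne_half_of_offPlane {a b : EuclideanSpace ℝ (Fin 3)} (ha : a ∈ fccSlots) (hb : b ∈ fccSlots)
    (ha2 : a 2 ≠ 0) (hb2 : b 2 ≠ 0) : ⟪a, basalMirror b⟫_ℝ ≠ 1 / 2 := by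
  have h23 : Real.sqrt (2 / 3) * Real.sqrt (2 / 3) = 2 / 3 := Real.mul_self_sqrt (by norm_num)
  rw [inner_basalMirror_right]
  have hab : a 2 * b 2 = 2 / 3 ∨ a 2 * b 2 = -(2 / 3) := by
    rcases slot_apply_two_cases ha with h | h | h
    · exact absurd h ha2
    · rcases slot_apply_two_cases hb with h' | h' | h'
      · exact absurd h' hb2
      · left; rw [h, h', h23]
      · right; rw [h, h', mul_neg, h23]
    · rcases slot_apply_two_cases hb with h' | h' | h'
      · exact absurd h' hb2
      · right; rw [h, h', neg_mul, h23]
      · left; rw [h, h', neg_mul_neg, h23]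
  rcases inner_slots_mem ha hb with h | h | h | h | h <;> rcases hab with h' | h' <;> rw [h, h'] <;> norm_num

/-- Membership in `D₋` unfolded: `y = basalMirror b` for a slot `b`. -/
theorem mem_image_basalMirror_iff {y : EuclideanSpace ℝ (Fin 3)} :
    y ∈ (basalMirror : EuclideanSpace ℝ (Fin 3) → EuclideanSpace ℝ (Fin 3)) '' ↑fccSlots ↔
      ∃ b ∈ fccSlots, basalMirror b = y := by
  simp only [Set.mem_image, mem_coe]

/-- A basal slot lies in `D₋` as well. -/
theorem mem_image_basalMirror_of_basal {w : EuclideanSpace ℝ (Fin 3)} (hw : w ∈ fccSlots) (hw2 : w 2 = 0) :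
    w ∈ (basalMirror : EuclideanSpace ℝ (Fin 3) → EuclideanSpace ℝ (Fin 3)) '' ↑fccSlots :=
  mem_image_basalMirror_iff.2 ⟨w, hw, basalMirror_of_inPlane hw2⟩

/-- One step of purity: if `x = basalMirror x'` with `x'` an off-plane slot and `y ∈ D₊ ∪ D₋` meets `x` at `60°`, then
`y ∈ D₋`. -/
theorem mem_image_of_inner_half {x' y : EuclideanSpace ℝ (Fin 3)} (hx' : x' ∈ fccSlots) (hx'2 : x' 2 ≠ 0)
    (hy : y ∈ fccSlots ∨ y ∈ (basalMirror : EuclideanSpace ℝ (Fin 3) → EuclideanSpace ℝ (Fin 3)) '' ↑fccSlots)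
    (h : ⟪y, basalMirror x'⟫_ℝ = 1 / 2) :
    y ∈ (basalMirror : EuclideanSpace ℝ (Fin 3) → EuclideanSpace ℝ (Fin 3)) '' ↑fccSlots := by
  rcases hy with hy | hy
  · by_cases hy2 : y 2 = 0
    · exact mem_image_basalMirror_of_basal hy hy2
    · exact absurd h (inner_ne_half_of_offPlane hy hx' hy2 hx'2)
  · exact hy

/-- **A `60°` triangle inside `D₊ ∪ D₋` lies in `D₊` or in `D₋`.** -/
theorem face_pure_of_neighbourMenu {a b c : EuclideanSpace ℝ (Fin 3)}
    (ha : a ∈ fccSlots ∨ a ∈ (basalMirror : EuclideanSpace ℝ (Fin 3) → EuclideanSpace ℝ (Fin 3)) '' ↑fccSlots)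
    (hb : b ∈ fccSlots ∨ b ∈ (basalMirror : EuclideanSpace ℝ (Fin 3) → EuclideanSpace ℝ (Fin 3)) '' ↑fccSlots)
    (hc : c ∈ fccSlots ∨ c ∈ (basalMirror : EuclideanSpace ℝ (Fin 3) → EuclideanSpace ℝ (Fin 3)) '' ↑fccSlots)
    (hab : ⟪a, b⟫_ℝ = 1 / 2) (hac : ⟪a, c⟫_ℝ = 1 / 2) (hbc : ⟪b, c⟫_ℝ = 1 / 2) :
    (a ∈ fccSlots ∧ b ∈ fccSlots ∧ c ∈ fccSlots) ∨
      (a ∈ (basalMirror : EuclideanSpace ℝ (Fin 3) → EuclideanSpace ℝ (Fin 3)) '' ↑fccSlots ∧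
        b ∈ (basalMirror : EuclideanSpace ℝ (Fin 3) → EuclideanSpace ℝ (Fin 3)) '' ↑fccSlots ∧
        c ∈ (basalMirror : EuclideanSpace ℝ (Fin 3) → EuclideanSpace ℝ (Fin 3)) '' ↑fccSlots) := by
  -- an element outside `D₊` is the mirror image of an off-plane slot, and then pulls the other two into `D₋`
  have pull : ∀ {x y z : EuclideanSpace ℝ (Fin 3)}, x ∉ fccSlots →
      (x ∈ fccSlots ∨ x ∈ (basalMirror : EuclideanSpace ℝ (Fin 3) → EuclideanSpace ℝ (Fin 3)) '' ↑fccSlots) →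
      (y ∈ fccSlots ∨ y ∈ (basalMirror : EuclideanSpace ℝ (Fin 3) → EuclideanSpace ℝ (Fin 3)) '' ↑fccSlots) →
      (z ∈ fccSlots ∨ z ∈ (basalMirror : EuclideanSpace ℝ (Fin 3) → EuclideanSpace ℝ (Fin 3)) '' ↑fccSlots) →
      ⟪y, x⟫_ℝ = 1 / 2 → ⟪z, x⟫_ℝ = 1 / 2 →
      (x ∈ (basalMirror : EuclideanSpace ℝ (Fin 3) → EuclideanSpace ℝ (Fin 3)) '' ↑fccSlots ∧
        y ∈ (basalMirror : EuclideanSpace ℝ (Fin 3) → EuclideanSpace ℝ (Fin 3)) '' ↑fccSlots ∧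
        z ∈ (basalMirror : EuclideanSpace ℝ (Fin 3) → EuclideanSpace ℝ (Fin 3)) '' ↑fccSlots) := by
    intro x y z hxn hx hy hz hyx hzx
    have hxM : x ∈ (basalMirror : EuclideanSpace ℝ (Fin 3) → EuclideanSpace ℝ (Fin 3)) '' ↑fccSlots :=
      hx.resolve_left hxn
    obtain ⟨x', hx', rfl⟩ := mem_image_basalMirror_iff.1 hxM
    have hx'2 : x' 2 ≠ 0 := by
      intro h0; rw [basalMirror_of_inPlane h0] at hxn; exact hxn hx'
    exact ⟨hxM, mem_image_of_inner_half hx' hx'2 hy hyx, mem_image_of_inner_half hx' hx'2 hz hzx⟩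
  by_cases haS : a ∈ fccSlots
  · by_cases hbS : b ∈ fccSlots
    · by_cases hcS : c ∈ fccSlots
      · exact Or.inl ⟨haS, hbS, hcS⟩
      · obtain ⟨h1, h2, h3⟩ := pull hcS hc ha hb hac hbc
        exact Or.inr ⟨h2, h3, h1⟩
    · obtain ⟨h1, h2, h3⟩ := pull hbS hb ha hc hab (by rw [real_inner_comm]; exact hbc)
      exact Or.inr ⟨h2, h1, h3⟩
  · obtain ⟨h1, h2, h3⟩ := pull haS ha hb hc (by rw [real_inner_comm]; exact hab) (by rw [real_inner_comm]; exact hac)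
    exact Or.inr ⟨h1, h2, h3⟩

/-! ### The frame lemma -/

section Frame

variable {s : ℤ → ℤ} (hs : IsHaggSeq s) {X : Finset (EuclideanSpace ℝ (Fin 3))} {q : EuclideanSpace ℝ (Fin 3)}
  (hq : q ∈ barlowStacking 1 (Real.sqrt (2 / 3)) s)
  (hX : ∀ x ∈ X, dist q x = 1 → x ∈ barlowStacking 1 (Real.sqrt (2 / 3)) s)
include hs hq hX

/-- An occupied `G`-slot of `q` is a vector of `D₊ ∪ D₋`. -/
theorem slot_mem_neighbourMenu (G : EuclideanSpace ℝ (Fin 3) ≃ₗᵢ[ℝ] EuclideanSpace ℝ (Fin 3))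
    {w : EuclideanSpace ℝ (Fin 3)} (hw : w ∈ fccSlots) (hocc : q + G w ∈ X) :
    G w ∈ fccSlots ∨ G w ∈ (basalMirror : EuclideanSpace ℝ (Fin 3) → EuclideanSpace ℝ (Fin 3)) '' ↑fccSlots := by
  have hd : dist q (q + G w) = 1 := by
    rw [dist_eq_norm, sub_add_cancel_left, norm_neg, LinearIsometryEquiv.norm_map, norm_eq_one_of_mem_fccSlots hw]
  have := barlow_neighbour_mem hs hq (hX _ hocc hd) hd
  rwa [add_sub_cancel_left] at this

/-- **Core**: three occupied `G`-slots of `q` forming a `60°` face force `G '' fccSlots = D₊` or `= D₋`. -/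
theorem frame_of_face_occupied (G : EuclideanSpace ℝ (Fin 3) ≃ₗᵢ[ℝ] EuclideanSpace ℝ (Fin 3))
    {a b c : EuclideanSpace ℝ (Fin 3)} (ha : a ∈ fccSlots) (hb : b ∈ fccSlots) (hc : c ∈ fccSlots)
    (hab : ⟪a, b⟫_ℝ = 1 / 2) (hac : ⟪a, c⟫_ℝ = 1 / 2) (hbc : ⟪b, c⟫_ℝ = 1 / 2)
    (hoa : q + G a ∈ X) (hob : q + G b ∈ X) (hoc : q + G c ∈ X) :
    (G : EuclideanSpace ℝ (Fin 3) → EuclideanSpace ℝ (Fin 3)) '' ↑fccSlots = ↑fccSlots ∨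
      (G : EuclideanSpace ℝ (Fin 3) → EuclideanSpace ℝ (Fin 3)) '' ↑fccSlots =
        (basalMirror : EuclideanSpace ℝ (Fin 3) → EuclideanSpace ℝ (Fin 3)) '' ↑fccSlots := by
  have hGab : ⟪G a, G b⟫_ℝ = 1 / 2 := by rw [LinearIsometryEquiv.inner_map_map, hab]
  have hGac : ⟪G a, G c⟫_ℝ = 1 / 2 := by rw [LinearIsometryEquiv.inner_map_map, hac]
  have hGbc : ⟪G b, G c⟫_ℝ = 1 / 2 := by rw [LinearIsometryEquiv.inner_map_map, hbc]
  rcases face_pure_of_neighbourMenu (slot_mem_neighbourMenu hs hq hX G ha hoa) (slot_mem_neighbourMenu hs hq hX G hb hob)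
    (slot_mem_neighbourMenu hs hq hX G hc hoc) hGab hGac hGbc with ⟨h1, h2, h3⟩ | ⟨h1, h2, h3⟩
  · left
    have hrefl : ((LinearIsometryEquiv.refl ℝ (EuclideanSpace ℝ (Fin 3)) :
        EuclideanSpace ℝ (Fin 3) → EuclideanSpace ℝ (Fin 3)) '' ↑fccSlots) = ↑fccSlots := by
      simp
    have key := image_fccSlots_eq_of_triangle G (LinearIsometryEquiv.refl ℝ _) ha hb hc hab hac hbc
      (by rw [hrefl]; exact mem_coe.2 h1) (by rw [hrefl]; exact mem_coe.2 h2) (by rw [hrefl]; exact mem_coe.2 h3)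
    rwa [hrefl] at key
  · right
    exact image_fccSlots_eq_of_triangle G basalMirror ha hb hc hab hac hbc h1 h2 h3

/-- **FULL readings**: `IsFull X G q` forces `G '' fccSlots ∈ {D₊, D₋}`. -/
theorem frame_of_isFull_barlow {G : EuclideanSpace ℝ (Fin 3) ≃ₗᵢ[ℝ] EuclideanSpace ℝ (Fin 3)} (h : IsFull X G q) :
    (G : EuclideanSpace ℝ (Fin 3) → EuclideanSpace ℝ (Fin 3)) '' ↑fccSlots = ↑fccSlots ∨
      (G : EuclideanSpace ℝ (Fin 3) → EuclideanSpace ℝ (Fin 3)) '' ↑fccSlots =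
        (basalMirror : EuclideanSpace ℝ (Fin 3) → EuclideanSpace ℝ (Fin 3)) '' ↑fccSlots := by
  obtain ⟨a, ha, b, hb, c, hc, hab, hac, hbc⟩ := exists_model_face
  exact frame_of_face_occupied hs hq hX G ha hb hc hab hac hbc (h a ha) (h b hb) (h c hc)

/-- **TWIN-DOZEN readings**: `IsTwinReading X G m q` forces `G '' fccSlots ∈ {D₊, D₋}` (the lower face is occupied). -/
theorem frame_of_isTwinReading_barlow {G : EuclideanSpace ℝ (Fin 3) ≃ₗᵢ[ℝ] EuclideanSpace ℝ (Fin 3)}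
    {m : EuclideanSpace ℝ (Fin 3)} (h : IsTwinReading X G m q) :
    (G : EuclideanSpace ℝ (Fin 3) → EuclideanSpace ℝ (Fin 3)) '' ↑fccSlots = ↑fccSlots ∨
      (G : EuclideanSpace ℝ (Fin 3) → EuclideanSpace ℝ (Fin 3)) '' ↑fccSlots =
        (basalMirror : EuclideanSpace ℝ (Fin 3) → EuclideanSpace ℝ (Fin 3)) '' ↑fccSlots := by
  obtain ⟨⟨hm, hmenu⟩, hown, -, -⟩ := h
  have hm' : ‖-m‖ = 1 := by rw [norm_neg, hm]
  have hmenu' : ∀ w ∈ fccSlots, ⟪G w, -m⟫_ℝ = 0 ∨ ⟪G w, -m⟫_ℝ = Real.sqrt (2 / 3) ∨ ⟪G w, -m⟫_ℝ = -Real.sqrt (2 / 3) := by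
    intro w hw
    rcases hmenu w hw with h0 | h0 | h0
    · exact Or.inl (by rw [inner_neg_right, h0, neg_zero])
    · exact Or.inr (Or.inr (by rw [inner_neg_right, h0]))
    · exact Or.inr (Or.inl (by rw [inner_neg_right, h0, neg_neg]))
  have hr : 0 < Real.sqrt (2 / 3) := Real.sqrt_pos.2 (by norm_num)
  obtain ⟨a, ha, b, hb, c, hc, hna, hnb, hnc, hab, hac, hbc, -, -⟩ := exists_far_frame G hm' hmenu'
  have neg_of : ∀ {w : EuclideanSpace ℝ (Fin 3)}, ⟪G w, -m⟫_ℝ = Real.sqrt (2 / 3) → ⟪G w, m⟫_ℝ ≤ 0 := by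
    intro w hw; rw [inner_neg_right] at hw; linarith
  exact frame_of_face_occupied hs hq hX G ha hb hc hab hac hbc (hown a ha (neg_of hna)) (hown b hb (neg_of hnb))
    (hown c hc (neg_of hnc))

/-- **NARROW readings**: `IsNarrow X G d q` forces `G '' fccSlots ∈ {D₊, D₋}` (the positive face is occupied). -/
theorem frame_of_isNarrow_barlow {G : EuclideanSpace ℝ (Fin 3) ≃ₗᵢ[ℝ] EuclideanSpace ℝ (Fin 3)}
    {d : EuclideanSpace ℝ (Fin 3)} (h : IsNarrow X G d q) :
    (G : EuclideanSpace ℝ (Fin 3) → EuclideanSpace ℝ (Fin 3)) '' ↑fccSlots = ↑fccSlots ∨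
      (G : EuclideanSpace ℝ (Fin 3) → EuclideanSpace ℝ (Fin 3)) '' ↑fccSlots =
        (basalMirror : EuclideanSpace ℝ (Fin 3) → EuclideanSpace ℝ (Fin 3)) '' ↑fccSlots := by
  obtain ⟨-, m, ⟨hm, hmenu⟩, -, hpos⟩ := h
  have hr : 0 < Real.sqrt (2 / 3) := Real.sqrt_pos.2 (by norm_num)
  obtain ⟨a, ha, b, hb, c, hc, hna, hnb, hnc, hab, hac, hbc, -, -⟩ := exists_far_frame G hm hmenu
  exact frame_of_face_occupied hs hq hX G ha hb hc hab hac hbc (hpos a ha (by rw [hna]; exact hr))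
    (hpos b hb (by rw [hnb]; exact hr)) (hpos c hc (by rw [hnc]; exact hr))

/-- **THE FRAME LEMMA for movers**: every mover clause of an end move `IsEndMove X v G d q b` from a Barlow-window site
`q` (any version `v`) forces `G '' fccSlots = D₊` or `= D₋`. -/
theorem frame_of_isEndMove_barlow {v : WordVersion} {G : EuclideanSpace ℝ (Fin 3) ≃ₗᵢ[ℝ] EuclideanSpace ℝ (Fin 3)}
    {d b : EuclideanSpace ℝ (Fin 3)} (h : IsEndMove X v G d q b) :
    (G : EuclideanSpace ℝ (Fin 3) → EuclideanSpace ℝ (Fin 3)) '' ↑fccSlots = ↑fccSlots ∨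
      (G : EuclideanSpace ℝ (Fin 3) → EuclideanSpace ℝ (Fin 3)) '' ↑fccSlots =
        (basalMirror : EuclideanSpace ℝ (Fin 3) → EuclideanSpace ℝ (Fin 3)) '' ↑fccSlots := by
  rcases h with ⟨hread, -, -⟩ | ⟨m, htr, -, -, -⟩
  · rcases hread with hf | ⟨-, hn⟩ | ⟨m, htr, -⟩
    · exact frame_of_isFull_barlow hs hq hX hf
    · exact frame_of_isNarrow_barlow hs hq hX hn
    · exact frame_of_isTwinReading_barlow hs hq hX htr
  · exact frame_of_isTwinReading_barlow hs hq hX htr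

/-- The same for a MOVING state `IsMoving X v G d q` (used for the non-moving target clause bookkeeping). -/
theorem frame_of_isMoving_barlow {v : WordVersion} {G : EuclideanSpace ℝ (Fin 3) ≃ₗᵢ[ℝ] EuclideanSpace ℝ (Fin 3)}
    {d : EuclideanSpace ℝ (Fin 3)} (h : IsMoving X v G d q) :
    (G : EuclideanSpace ℝ (Fin 3) → EuclideanSpace ℝ (Fin 3)) '' ↑fccSlots = ↑fccSlots ∨
      (G : EuclideanSpace ℝ (Fin 3) → EuclideanSpace ℝ (Fin 3)) '' ↑fccSlots =
        (basalMirror : EuclideanSpace ℝ (Fin 3) → EuclideanSpace ℝ (Fin 3)) '' ↑fccSlots := by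
  rcases h with hf | ⟨m, htr, -⟩ | ⟨-, hn⟩
  · exact frame_of_isFull_barlow hs hq hX hf
  · exact frame_of_isTwinReading_barlow hs hq hX htr
  · exact frame_of_isNarrow_barlow hs hq hX hn

end Frame

end Summit.Ventures.Crystal3D.Theorems

end
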